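import Mathlib.FieldTheory.IsAlgClosed.AlgebraicClosure
import Mathlib.FieldTheory.AlgebraicClosure
import Mathlib.FieldTheory.KrullTopology
import Mathlib.FieldTheory.RatFunc.AsPolynomial
import Mathlib.GroupTheory.GroupAction.SubMulAction
import Literature.IUT.HodgeTheaters.KappaCoricGalois
import Literature.IUT.HodgeTheaters.GlobalFrobenioidsKummer
import HarnessLib

/-!
# [IUTchI] Definition 5.2 (v)/(vii) with Remark 3.1.7 (i), (ii): the LOCAL `∞κ`-coric layer at one place —
# arithmetic-function-field MODEL presentation, TYPES FIRST (GAP B = G-L5t9g8-1, item GB-02 = GAP-SIZING-B.md row D2)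

S. Mochizuki, *Inter-universal Teichmüller theory I*, kurims manuscript (May 2020), Definition 5.2 (v) p. 135
ll. 33–59 (nonarchimedean `v`), (vii) p. 139 (archimedean `v`), Remark 3.1.7 (i), (ii) pp. 66–67
([IUTchI] Def 5.2 (v) p.135) [claim: Mochizuki2012, status: disputed] (D-0012 claim key, series status DISPUTED —
this file TYPES print's local objects at OUR model presentation; nothing of the series is asserted and no side is
taken on [IUTchIII] Cor. 3.12).

## The printed objects

Def 5.2 (v) p. 135: «one may construct group-theoretically from `π₁(‡𝒟_v)`, in a functorial fashion, an isomorph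
`π₁^{rat}(‡𝒟_v) (↠ π₁(‡𝒟̄_v))` of the étale fundamental group … of the scheme obtained by base-changing to `(F_mod)_v`
the generic point of `C_{F_mod}` … as well as isomorphs of the pseudo-monoids of κ-, `∞κ`-, and `∞κ×`-coric rational
functions associated to `C_v` [cf. the discussion of Remark 3.1.7, (i), (ii) …] — which we shall denote
`𝕄_{κv}(‡𝒟_v), 𝕄_{∞κv}(‡𝒟_v), 𝕄_{∞κ×v}(‡𝒟_v)` — equipped with their natural `π₁^{rat}(‡𝒟_v)`-actions. Thus,
`𝕄_{κv}(‡𝒟_v)` may be identified with the subset of `π₁^{rat}(‡𝒟_v)`-invariants of `𝕄_{∞κv}(‡𝒟_v)`».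
Rmk 3.1.7 (i) p. 66: `L` is `F_mod` or a completion `(F_mod)_v`; a rational function `f ∈ L_C` is `κ`-coric if,
whenever `f ∉ L`, it has OVER `L̄` precisely one pole and at least two distinct zeroes, its divisor is defined over a
number field and avoids the critical points, and `f` restricts to roots of unity at the strictly critical points;
(ii) p. 67: `∞κ`-coric (`fⁿ` `κ`-coric, for `f ∈ L̄_C`), `∞κ×`-coric (`c·f` `∞κ`-coric for some `c ∈ U_L`,
«`U_L = 𝒪^×_L` if `L = (F_mod)_v`»).

## How it is typed here (MODEL presentation, abc-iut-L5-lead RULINGS #316 (i) «Λ_L := AlgebraicClosure (RatFunc L),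
## G_L^rat := Λ_L ≃ₐ[RatFunc L] Λ_L, ∞κ-coric sets via L5-t2 `IsInftyKappaCoricIn`», #315 (2) «`locRat`/`locInfkx`/
## `locInfk` = ‡𝕄_∞κv ⊆ ‡𝕄_∞κ×v at the genuine local data (t4 `CoricKit` shape)», #318 «divisors typed geometrically»)

For a field `L` of characteristic `0` (the local base field; generic, specialised to completions in
`KappaCoricRatGaloisLocalPlaces.lean`):
* `CriticalLocus.ratClosure L := AlgebraicClosure (RatFunc L)` — `Λ_L`, an algebraic closure of `L(t)` (model of `L̄_C`);
* `CriticalLocus.ratGalois L := Λ_L ≃ₐ[RatFunc L] Λ_L` with Mathlib's Krull topology — the MODEL of `π₁^{rat}(‡𝒟_v)`;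
* `CriticalLocus.geomConstants L : IntermediateField L Λ_L` — `L̄ ⊂ Λ_L`, the algebraic closure of `L` inside `Λ_L`
  (Mathlib `algebraicClosure`; an `IsAlgClosure L`), over which DIVISORS ARE COUNTED («over `L̄`», Rmk 3.1.7 (i); this
  is the geometric typing required by RULINGS #318 / GAP-SIZING-B.md §7 R1: the naive count over `L` is not base-change
  stable), together with `geomEmb L : RatFunc L̄ →ₐ[L̄] Λ_L`, `t ↦ t` (`t` is transcendental over `L̄`, PROVED);
* `CriticalLocus.toGeom S` — an `L`-rational strictly critical locus `S : CriticalLocus L` read over `L̄`;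
* `CriticalLocus.minfkSet S ⊆ CriticalLocus.minfkxSet S U ⊆ Λ_L` — the carriers of `𝕄_{∞κv}`, `𝕄_{∞κ×v}`: the elements
  of `Λ_L` that are `∞κ`-coric, resp. `∞κ×`-coric with unit parameter `U ⊆ L`, in the sense of abc-iut-L5-t2's
  `IsInftyKappaCoricIn` / `IsInftyKappaUnitCoricIn` (`KappaCoricGalois.lean`, BY NAME) for the critical locus
  `S.toGeom` and the algebra structure `geomEmb L`;
* the t4-SHAPE record `InfKappaCoricKit Γ` (= the fields `pi1rat ↷ Minfkx ⊇ Minfk` of abc-iut-L5-t4's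
  `PMBaseKit.CoricKit`, `FPrimeStripsCoric.lean`, at ONE place, in the vocabulary the consumer
  `S5Local.InfKappaLink.locInfkx/locInfk` (`FrobenioidBridgeModelsEx54ivInfKappa.lean` ★ p513361) expects: a
  `CoricPair Γ` (abc-iut-L5-t1, BY NAME) with a `Γ`-stable subset), its `𝕄_{κv} :=` the `Γ`-invariants of `𝕄_{∞κv}`
  (the printed identification, as a DEFINITION), and the bundled form `LocalInfKappaLayer` (group + topology + kit,
  bundled like `InfKappaLink`'s `locRat/locRatGroup/locRatTop`; the bundled instances are structure fields, NOT
  registered as global instances — consumers bind them with `letI`).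

The INHABITANT `CriticalLocus.infKappaCoricKit S U : InfKappaCoricKit (ratGalois L)` (Galois-stability of the two
carriers — NOT immediate here, since `σ ∈ Gal(Λ_L/L(t))` moves `L̄(t)`: it rests on "an `L`-conjugate of a `κ`-coric
function is `κ`-coric when the critical locus is `L`-rational" — open stabilisers in the Krull topology, the
pseudo-monoid structure) is the companion file `KappaCoricRatGaloisLocalKit.lean` (signature-first rule, abc-iut-L5-lead
RULINGS #330 (2)(d)).  TODO-merge:abc-iut-gapB-01 (the RatGalois layer `RatAlgClosure`/`RatGal` of GAP B item GB-01 is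
the same pair of Mathlib terms; `ratClosure`/`ratGalois` are `abbrev`s, hence definitionally interchangeable).

HONEST LABELS: (1) MODEL presentation — print DEFINES `𝕄_{∞κv}(‡𝒟_v)` etc. by group-theoretic reconstruction from
`π₁(‡𝒟_v)` ([AbsTopIII] Thm 1.9, Cor 1.10); here the objects are the arithmetic function-field models they are
isomorphs of (#316 (i): content at model presentation, count-neutral; provenance = GAP B items GB-10 ff.);
(2) `π₁^{rat}` is modelled by the absolute Galois group of `L(t)` = the function field of the COARSE space
`|C_L| ≅ ℙ¹_L` in the coordinate with the cusp at `∞` (abc-iut-L5-t2's convention in `KappaCoricFunctions.lean`);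
(3) at archimedean `v` print's `π₁^{rat}(‡𝒟_v)` is Aut-holomorphic (Def 5.2 (vii) p. 139: deck transformations of
`‡𝒟^{rat}_v → ‡𝒟̄_v`), Galois-shaped here only as a MODEL label (GAP-SIZING-B.md R3).  Record/definitions only: no
instance, no notation, no axiom, no `sorry`; typed ≠ inhabited ≠ proved-in-print; count-neutral until the chair
tokens the row; nothing here asserts that abc is proved or refuted.
-/

noncomputable section

namespace Literature.IUT.HodgeTheaters

open Polynomial
open scoped RatFunc

universe u

/-! ### The t4-shape kit at one place, and its bundled form -/

/-- **The t4-SHAPE `∞κ`-coric kit at ONE place** — the part of abc-iut-L5-t4's `PMBaseKit.CoricKit` that [IUTchI]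
Ex 5.4 (iv) consumes, in the consumer's vocabulary (`S5Local.InfKappaLink.locInfkx/locInfk`): for a topological
group `Γ` (an isomorph of `π₁^{rat}(‡𝒟_v)`), the `∞κ×`-coric structure `Γ ↷ 𝕄_{∞κ×v}` as a `CoricPair` («pseudo-monoids
of … `∞κ×`-coric rational functions associated to `C_v` … equipped with their natural `π₁^{rat}(‡𝒟_v)`-actions»,
Def 5.2 (v) p. 135) and its `Γ`-stable sub-structure `𝕄_{∞κv} ⊆ 𝕄_{∞κ×v}` (Def 5.2 (vi) p. 137 display).
([IUTchI] Def 5.2 (v) p.135) [claim: Mochizuki2012, status: disputed] -/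
structure InfKappaCoricKit (Γ : Type u) [Group Γ] [TopologicalSpace Γ] : Type (u + 1) where
  /-- `Γ ↷ 𝕄_{∞κ×v}`: a pseudo-monoid with continuous `Γ`-action (abc-iut-L5-t1's `CoricPair`, BY NAME). -/
  infkx : CoricPair Γ
  /-- `𝕄_{∞κv} ⊆ 𝕄_{∞κ×v}`, a `Γ`-stable subset. -/
  infk : SubMulAction Γ infkx.carrier

namespace InfKappaCoricKit

variable {Γ : Type u} [Group Γ] [TopologicalSpace Γ] (𝒦 : InfKappaCoricKit Γ)

/-- `𝕄_{κv}`: «`𝕄_{κv}(‡𝒟_v)` may be identified with the subset of `π₁^{rat}(‡𝒟_v)`-invariants of `𝕄_{∞κv}(‡𝒟_v)`»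
(Def 5.2 (v) p. 135 ll. 57–59) — taken as the DEFINITION of the `κ`-coric part of a kit.
([IUTchI] Def 5.2 (v) p.135) [claim: Mochizuki2012, status: disputed] -/
def kappa : Set 𝒦.infkx.carrier := {f | f ∈ 𝒦.infk ∧ ∀ g : Γ, g • f = f}

/-- `𝕄_{κv} ⊆ 𝕄_{∞κv}`. ([IUTchI] Def 5.2 (v) p.135) [claim: Mochizuki2012, status: disputed] -/
theorem kappa_subset_infk : 𝒦.kappa ⊆ (𝒦.infk : Set 𝒦.infkx.carrier) := fun _ hf => hf.1

/-- Membership in `𝕄_{κv}`: an invariant element of `𝕄_{∞κv}`. ([IUTchI] Def 5.2 (v) p.135)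
[claim: Mochizuki2012, status: disputed] -/
theorem mem_kappa_iff (f : 𝒦.infkx.carrier) : f ∈ 𝒦.kappa ↔ f ∈ 𝒦.infk ∧ ∀ g : Γ, g • f = f := Iff.rfl

/-- `𝕄_{κv}` is `Γ`-stable (indeed pointwise fixed). ([IUTchI] Def 5.2 (v) p.135) [claim: Mochizuki2012, status: disputed] -/
theorem smul_mem_kappa {f : 𝒦.infkx.carrier} (hf : f ∈ 𝒦.kappa) (g : Γ) : g • f ∈ 𝒦.kappa := by
  rw [hf.2 g]; exact hf

end InfKappaCoricKit

/-- **The local `∞κ`-coric layer at one place, BUNDLED** exactly in the shape of the `loc*` fields of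
`S5Local.InfKappaLink` (★ p513361): the group `π₁^{rat}(‡𝒟_v)` (a type with group structure and topology carried as
structure fields — NOT registered as instances; bind with `letI`) and its t4-shape kit.  This is the form in which
a uniform-in-`v ∈ 𝕍` local layer is delivered (`KappaCoricRatGaloisLocalPlaces.lean`), so that the link knit of GAP B
(item D4) needs no case analysis on the place. ([IUTchI] Def 5.2 (v) p.135) [claim: Mochizuki2012, status: disputed] -/
structure LocalInfKappaLayer : Type (u + 1) where
  /-- `π₁^{rat}(‡𝒟_v)` (model) … -/
  rat : Type u
  /-- … a group … -/
  [ratGroup : Group rat]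
  /-- … a topological group. -/
  [ratTop : TopologicalSpace rat]
  /-- the t4-shape kit `π₁^{rat}(‡𝒟_v) ↷ 𝕄_{∞κ×v} ⊇ 𝕄_{∞κv}`. -/
  kit : InfKappaCoricKit rat

/-! ### The model objects over a field `L` of characteristic `0` -/

namespace CriticalLocus

variable (L : Type u) [Field L]

/-- `Λ_L`: an algebraic closure of the rational function field `L(t)` — the MODEL of `L̄_C` (Rmk 3.1.7 (ii) p. 67:
«`L̄_C` … an algebraic closure of `L_C`»; the coarse space of `C_L` is `ℙ¹_L`, `KappaCoricFunctions.lean`).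
TODO-merge:abc-iut-gapB-01 (`RatAlgClosure`, same term). ([IUTchI] Rmk 3.1.7 (ii) p.67) [claim: Mochizuki2012, status: disputed] -/
abbrev ratClosure : Type u := AlgebraicClosure (RatFunc L)

/-- `G_L^{rat} := Gal(Λ_L / L(t))` with the Krull topology — the arithmetic-function-field MODEL of `π₁^{rat}(‡𝒟_v)`
(«an isomorph … of the étale fundamental group … of the scheme obtained by base-changing to `(F_mod)_v` the generic
point of `C_{F_mod}`», Def 5.2 (v) p. 135 ll. 36–43; MODEL label (2)/(3) of the module docstring).
TODO-merge:abc-iut-gapB-01 (`RatGal`, same term). ([IUTchI] Def 5.2 (v) p.135) [claim: Mochizuki2012, status: disputed] -/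
abbrev ratGalois : Type u := ratClosure L ≃ₐ[RatFunc L] ratClosure L

/-- `L̄ ⊂ Λ_L`: the GEOMETRIC CONSTANTS — the algebraic closure of `L` inside `Λ_L` (Mathlib `algebraicClosure`, an
`IsAlgClosure L`); the field over which divisors of rational functions are counted («over `L̄`», Rmk 3.1.7 (i) p. 66).
([IUTchI] Rmk 3.1.7 (i) p.66) [claim: Mochizuki2012, status: disputed] -/
abbrev geomConstants : IntermediateField L (ratClosure L) := algebraicClosure L (ratClosure L)

/-- The coordinate `t` of `|C_L| ≅ 𝔸¹_L ∪ {∞}` (cusp at `∞`) as an element of `Λ_L`.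
([IUTchI] Rmk 3.1.7 (i) p.66) [claim: Mochizuki2012, status: disputed] -/
def ratVar : ratClosure L := algebraMap (RatFunc L) (ratClosure L) RatFunc.X

/-- `t ∈ Λ_L` is transcendental over `L` (it is the image of `RatFunc.X`). ([IUTchI] Rmk 3.1.7 (i) p.66)
[claim: Mochizuki2012, status: disputed] -/
theorem ratVar_transcendental_base : Transcendental L (ratVar L) := by
  rw [ratVar, transcendental_algebraMap_iff (algebraMap (RatFunc L) (ratClosure L)).injective]
  exact RatFunc.transcendental_X

/-- `t ∈ Λ_L` is transcendental over the geometric constants `L̄` (which are algebraic over `L`).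
([IUTchI] Rmk 3.1.7 (i) p.66) [claim: Mochizuki2012, status: disputed] -/
theorem ratVar_transcendental : Transcendental (geomConstants L) (ratVar L) :=
  (Algebra.IsAlgebraic.transcendental_iff L (geomConstants L)).mp (ratVar_transcendental_base L)

/-- `L̄(t) ↪ Λ_L`: the geometric rational functions inside `Λ_L` — the `L̄`-algebra map `RatFunc L̄ → Λ_L` sending
`t ↦ t` (Mathlib `RatFunc.algEquivOfTranscendental` onto `L̄(t) ⊆ Λ_L`, followed by the inclusion).
([IUTchI] Rmk 3.1.7 (i) p.66) [claim: Mochizuki2012, status: disputed] -/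
def geomEmb : RatFunc (geomConstants L) →ₐ[geomConstants L] ratClosure L :=
  (IntermediateField.val _).comp
    (RatFunc.algEquivOfTranscendental (ratVar L) (ratVar_transcendental L)).toAlgHom

/-- `geomEmb` sends `t ↦ t`. ([IUTchI] Rmk 3.1.7 (i) p.66) [claim: Mochizuki2012, status: disputed] -/
theorem geomEmb_X : geomEmb L RatFunc.X = ratVar L := by
  simp [geomEmb]

/-- `geomEmb` on constants is the inclusion `L̄ ⊂ Λ_L`. ([IUTchI] Rmk 3.1.7 (i) p.66) [claim: Mochizuki2012, status: disputed] -/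
theorem geomEmb_C (c : geomConstants L) : geomEmb L (RatFunc.C c) = (c : ratClosure L) := by
  have : RatFunc.C c = algebraMap (geomConstants L) (RatFunc (geomConstants L)) c := rfl
  rw [this, AlgHom.commutes]
  rfl

/-- `geomEmb` is injective (a ring map out of a field). ([IUTchI] Rmk 3.1.7 (i) p.66) [claim: Mochizuki2012, status: disputed] -/
theorem geomEmb_injective : Function.Injective (geomEmb L) := (geomEmb L).toRingHom.injective

variable {L}

/-- An `L`-rational strictly critical locus read over the geometric constants `L̄` (the three points are images of
`F`-rational `2`-torsion points, Def 3.1 (b), hence rational over any `L ⊇ F`; R4 of GAP-SIZING-B.md).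
([IUTchI] Rmk 3.1.7 (i) p.66) [claim: Mochizuki2012, status: disputed] -/
def toGeom (S : CriticalLocus L) : CriticalLocus (geomConstants L) :=
  ⟨S.pts.map ⟨algebraMap L (geomConstants L), (algebraMap L (geomConstants L)).injective⟩,
    by rw [Finset.card_map]; exact S.card_eq⟩

/-- The points of `S.toGeom` are the images of the points of `S`. ([IUTchI] Rmk 3.1.7 (i) p.66)
[claim: Mochizuki2012, status: disputed] -/
theorem mem_toGeom_pts_iff (S : CriticalLocus L) (e : geomConstants L) :
    e ∈ S.toGeom.pts ↔ ∃ a ∈ S.pts, algebraMap L (geomConstants L) a = e := by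
  simp [toGeom]

variable [CharZero L] (S : CriticalLocus L)

/-- **The carrier of `𝕄_{∞κv}`** inside `Λ_L`: the `∞κ`-coric elements — «`f ∈ L̄_C` is `∞κ`-coric if there exists a
positive integer `n` such that `fⁿ` is a `κ`-coric element» (Rmk 3.1.7 (ii) p. 67) — abc-iut-L5-t2's
`IsInftyKappaCoricIn` BY NAME, for the critical locus over `L̄` and the algebra structure `geomEmb` (divisors counted
over `L̄`, #318). ([IUTchI] Rmk 3.1.7 (ii) p.67) [claim: Mochizuki2012, status: disputed] -/
def minfkSet : Set (ratClosure L) :=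
  letI : Algebra (RatFunc (geomConstants L)) (ratClosure L) := (geomEmb L).toRingHom.toAlgebra
  {x | S.toGeom.IsInftyKappaCoricIn (ratClosure L) x}

/-- **The carrier of `𝕄_{∞κ×v}`** inside `Λ_L`: the `∞κ×`-coric elements with unit parameter `U ⊆ L` — «there exists an
element `c ∈ U_L` such that `c·f` is `∞κ`-coric», «`U_L = 𝒪^×_L` if `L = (F_mod)_v`» (Rmk 3.1.7 (ii) p. 67) —
abc-iut-L5-t2's `IsInftyKappaUnitCoricIn` BY NAME (constants `c ∈ U` read in `L̄`).
([IUTchI] Rmk 3.1.7 (ii) p.67) [claim: Mochizuki2012, status: disputed] -/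
def minfkxSet (U : Set L) : Set (ratClosure L) :=
  letI : Algebra (RatFunc (geomConstants L)) (ratClosure L) := (geomEmb L).toRingHom.toAlgebra
  {x | S.toGeom.IsInftyKappaUnitCoricIn (ratClosure L) (algebraMap L (geomConstants L) '' U) x}

/-- Membership in `𝕄_{∞κv}`, unfolded: `xⁿ` is (the image of) a `κ`-coric `g ∈ L̄(t)` for some `n ≥ 1`.
([IUTchI] Rmk 3.1.7 (ii) p.67) [claim: Mochizuki2012, status: disputed] -/
theorem mem_minfkSet_iff (x : ratClosure L) :
    x ∈ S.minfkSet ↔ ∃ n : ℕ, 0 < n ∧ ∃ g : RatFunc (geomConstants L), S.toGeom.IsKappaCoric g ∧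
      x ^ n = geomEmb L g :=
  Iff.rfl

/-- Membership in `𝕄_{∞κ×v}`, unfolded: `c·x` is `∞κ`-coric for some `c ∈ U`.
([IUTchI] Rmk 3.1.7 (ii) p.67) [claim: Mochizuki2012, status: disputed] -/
theorem mem_minfkxSet_iff (U : Set L) (x : ratClosure L) :
    x ∈ S.minfkxSet U ↔ ∃ c ∈ U, (geomEmb L (RatFunc.C (algebraMap L (geomConstants L) c)) * x) ∈ S.minfkSet := by
  constructor
  · rintro ⟨c', ⟨c, hc, rfl⟩, h⟩
    exact ⟨c, hc, h⟩
  · rintro ⟨c, hc, h⟩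
    exact ⟨_, ⟨c, hc, rfl⟩, h⟩

/-- `𝕄_{∞κv} ⊆ 𝕄_{∞κ×v}` as soon as `1 ∈ U` (as for `U = 𝒪^×`): take `c = 1`.
([IUTchI] Rmk 3.1.7 (ii) p.67) [claim: Mochizuki2012, status: disputed] -/
theorem minfkSet_subset_minfkxSet {U : Set L} (hU : (1 : L) ∈ U) : S.minfkSet ⊆ S.minfkxSet U := by
  intro x hx
  rw [mem_minfkxSet_iff]
  refine ⟨1, hU, ?_⟩
  simpa using hx

end CriticalLocus

end Literature.IUT.HodgeTheaters

end
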